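import Mathlib
import HarnessLib
import Literature.MathematicalPhysics.StatisticalMechanics.WeightDataABKM
import Literature.MathematicalPhysics.StatisticalMechanics.LatticeSobolevDeriv

/-!
# Lemma 7.8 and Theorem 7.1 (w9) for the [ABKM19] weight data on the torus:
# the field norm is controlled by the added form, `|φ|²_{k+1,X} ≤ (φ, δ_{k+1}M_{k+1}^X φ)`

[ABKM19] Lemma 7.8: for a `(k+1)`-polymer `X`, the field gauge
`|φ|_{k+1,X} = max_{x∈X*} max_{1≤|α|≤p} 𝔥⁻¹R^{|α|}|∇^αφ(x)|` (`R = L^{k+1}`, `𝔥 = h_{k+1}L^{−(k+1)(d−2)/2}`)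
satisfies `|φ|²_{k+1,X} ≤ (φ, δ_{k+1}M_{k+1}^Xφ)` once `h ≥ h₀`; consequently (Theorem 7.1 (w9))
`e^{|φ|²_{k+1,X}/2} w_{k:k+1}^X(φ) ≤ w_{k+1}^X(φ)`.  The proof is the discrete Sobolev inequality
on a cube through `x ∈ X*` that stays inside `X⁺` (where the box density `χ_X ≥ 1`), here in the
mixed-derivative form of the tree (`LatticeSobolevDeriv.iterDiff_sq_le_sum`, orders up to
`p + d ≤ M_ord`, constant `8^d`):

* `injective_natVecFin`, `supNorm_natVecFin_le` (the cube `x + [0,ℓ)^d` on the torus);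
* `sum_box_sq_le_quadForm` — `Σ_{v∈[0,ℓ)^d}(∇^γφ(x+v))² ≤ L^{−2(k+1)(|γ|−1)}(φ, M_{k+1}^Xφ)` when
  `x + [0,ℓ)^d ⊆ X⁺`;
* **`iterDiff_sq_le_quadForm`** — `(∇^αφ(x))² ≤ 8^d R^{2−d−2|α|}(φ, M_{k+1}^Xφ)` for `x ∈ X*`
  ((7.88) with `M'3^{2M'}S(d) ↦ 8^d`);
* **`fieldGauge_sq_le_pert`** — Lemma 7.8: `‖T_{X*}φ‖² ≤ (φ, pert_{k+1}^X φ)` provided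
  `8^dθ_max ≤ δ'_{k+1}𝔥²R^{d−2}` (`= δ'_{k+1}h_{k+1}²` for [ABKM19]'s `𝔥`: the condition `h ≥ h₀(L)`);
* **`exp_fieldGauge_sq_mul_midWeight_le`** — Theorem 7.1 (w9) for `abkmWeightData`.

Everything is proved; no named fact.

## References
* S. Adams, S. Buchholz, R. Kotecký, S. Müller, arXiv:1910.13564, Lemma 7.8, Lemma 7.9,
  Theorem 7.1 (w9), (6.40)–(6.41) [AdamsBuchholzKoteckyMuller2019].
-/

noncomputable section

namespace Literature.MathematicalPhysics.StatisticalMechanics.GradientRG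

open Finset Matrix Real
open scoped MatrixOrder
open Literature.MathematicalPhysics.StatisticalMechanics.GradientFRD (iterDiff supNorm mulMat fourierCoeff)
open Literature.MathematicalPhysics.StatisticalMechanics.TorusPolymer
  (ball thicken mem_ball mem_thicken thicken_thicken thicken_mono thicken_mono_rad subset_thicken
    IsPolymer)

variable {d M : ℕ} [NeZero M]

/-! ## The cube `x + [0,ℓ)^d` on the torus -/

/-- The torus vector of `v ∈ [0,ℓ)^d`. [cite: AdamsBuchholzKoteckyMuller2019, Lemma 7.9] -/
def natVecFin {ℓ : ℕ} (v : Fin d → Fin ℓ) : Fin d → ZMod M := fun k => ((v k : ℕ) : ZMod M)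

omit [NeZero M] in
/-- `v ↦ x + v` is injective on `[0,ℓ)^d` for `ℓ ≤ M`. [cite: AdamsBuchholzKoteckyMuller2019, Lemma 7.9] -/
theorem injective_natVecFin {ℓ : ℕ} (hℓ : ℓ ≤ M) (x : Fin d → ZMod M) :
    Function.Injective fun v : Fin d → Fin ℓ => x + natVecFin v := by
  intro v w hvw
  funext k
  have h := congrFun (add_left_cancel hvw) k
  simp only [natVecFin] at h
  have h' := congrArg ZMod.val h
  rw [ZMod.val_cast_of_lt (lt_of_lt_of_le (v k).isLt hℓ),
    ZMod.val_cast_of_lt (lt_of_lt_of_le (w k).isLt hℓ)] at h'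
  exact Fin.ext h'

/-- `|v|_∞ ≤ ℓ − 1` for `v ∈ [0,ℓ)^d`. [cite: AdamsBuchholzKoteckyMuller2019, Lemma 7.9] -/
theorem supNorm_natVecFin_le {ℓ : ℕ} (v : Fin d → Fin ℓ) : supNorm (natVecFin (M := M) v) ≤ ℓ - 1 := by
  rw [TorusPolymer.supNorm_le_iff]
  intro k
  exact (natAbs_valMinAbs_natCast_le (v k : ℕ)).trans (by have := (v k).isLt; omega)

/-! ## One Sobolev term against the added form -/

/-- `|α + 𝟙_β| = |α| + #β`. [cite: AdamsBuchholzKoteckyMuller2019, Lemma 7.9] -/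
theorem sum_add_indicator (α : Fin d → ℕ) (β : Finset (Fin d)) :
    ∑ k, (α + (fun k => if k ∈ β then 1 else 0 : Fin d → ℕ)) k = ∑ k, α k + β.card := by
  simp only [Pi.add_apply, Finset.sum_add_distrib, Finset.sum_boole, Nat.cast_id]
  simp

/-- **A cube inside `{χ ≥ 1}` is dominated by the weighted sum**: for `f ≥ 0`, `χ ≥ 0` with `χ ≥ 1`
on the points `x + v`, `v ∈ [0,ℓ)^d` (`ℓ ≤ M`): `Σ_v f(x+v) ≤ Σ_y χ(y) f(y)`.
[cite: AdamsBuchholzKoteckyMuller2019, Lemma 7.8 (7.88)] -/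
theorem sum_box_le_sum_mul {ℓ : ℕ} (hℓ : ℓ ≤ M) (x : Fin d → ZMod M) {f χ : (Fin d → ZMod M) → ℝ}
    (hf : ∀ y, 0 ≤ f y) (hχ : ∀ y, 0 ≤ χ y) (hχ1 : ∀ v : Fin d → Fin ℓ, 1 ≤ χ (x + natVecFin v)) :
    ∑ v : Fin d → Fin ℓ, f (x + natVecFin v) ≤ ∑ y, χ y * f y := by
  classical
  rw [← Finset.sum_image (f := fun y => f y) (s := Finset.univ)
    (fun v _ w _ h => injective_natVecFin hℓ x h)]
  calc ∑ y ∈ Finset.univ.image (fun v : Fin d → Fin ℓ => x + natVecFin v), f y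
      ≤ ∑ y ∈ Finset.univ.image (fun v : Fin d → Fin ℓ => x + natVecFin v), χ y * f y := by
        refine Finset.sum_le_sum fun y hy => ?_
        obtain ⟨v, -, rfl⟩ := Finset.mem_image.1 hy
        exact le_mul_of_one_le_left (hf _) (hχ1 v)
    _ ≤ ∑ y, χ y * f y :=
        Finset.sum_le_sum_of_subset_of_nonneg (Finset.subset_univ _) fun y _ _ => mul_nonneg (hχ y) (hf y)

/-- **One term of the Sobolev sum against `M_{k+1}^X`**: for `γ ∈ s` and a cube `x + [0,ℓ)^d` on which
`χ ≥ 1`: `Σ_v (∇^γφ(x+v))² ≤ L^{−2j(|γ|−1)} (φ, derivForm L j s χ φ)`.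
[cite: AdamsBuchholzKoteckyMuller2019, Lemma 7.8 (7.88)] -/
theorem sum_box_sq_le_quadForm {ℓ : ℕ} (hℓ : ℓ ≤ M) (x : Fin d → ZMod M) {L : ℝ} (hL : 0 < L)
    (j : ℕ) {s : Finset (Fin d → ℕ)} {γ : Fin d → ℕ} (hγ : γ ∈ s) {χ : (Fin d → ZMod M) → ℝ}
    (hχ : ∀ y, 0 ≤ χ y) (hχ1 : ∀ v : Fin d → Fin ℓ, 1 ≤ χ (x + natVecFin v))
    (φ : (Fin d → ZMod M) → ℝ) :
    ∑ v : Fin d → Fin ℓ, (iterDiff γ φ (x + natVecFin v)) ^ 2 ≤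
      (L ^ (2 * j * (∑ i, γ i - 1)))⁻¹ * (φ ⬝ᵥ derivForm L j s χ *ᵥ φ) := by
  have h1 := sum_box_le_sum_mul hℓ x (f := fun y => (iterDiff γ φ y) ^ 2) (fun y => sq_nonneg _) hχ hχ1
  rw [dotProduct_derivForm_mulVec]
  have hpos : 0 < L ^ (2 * j * (∑ i, γ i - 1)) := pow_pos hL _
  rw [le_inv_mul_iff₀ hpos]
  calc L ^ (2 * j * (∑ i, γ i - 1)) * ∑ v : Fin d → Fin ℓ, iterDiff γ φ (x + natVecFin v) ^ 2
      ≤ L ^ (2 * j * (∑ i, γ i - 1)) * ∑ y, χ y * iterDiff γ φ y ^ 2 :=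
        mul_le_mul_of_nonneg_left h1 hpos.le
    _ ≤ ∑ α ∈ s, L ^ (2 * j * (∑ i, α i - 1)) * ∑ y, χ y * iterDiff α φ y ^ 2 :=
        Finset.single_le_sum (f := fun α => L ^ (2 * j * (∑ i, α i - 1)) * ∑ y, χ y * iterDiff α φ y ^ 2)
          (fun α _ => mul_nonneg (pow_nonneg hL.le _)
            (Finset.sum_nonneg fun y _ => mul_nonneg (hχ y) (sq_nonneg _))) hγ

/-! ## Lemma 7.8 for `abkmWeightData` -/

/-- `2·starRad_{k+1} ≤ L^{k+1}` for `L ≥ 2^{d+3} + 16R` (the star fits twice into the next block).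
[cite: AdamsBuchholzKoteckyMuller2019, Ch. 6.2 (6.26)] -/
theorem two_mul_starRad_le {L R : ℕ} (hL : 2 ^ (d + 3) + 16 * R ≤ L) (k : ℕ) :
    2 * starRad R L d (k + 1) ≤ L ^ (k + 1) := by
  have h8 : 2 ^ d * 8 = 2 ^ (d + 3) := by rw [pow_add]; norm_num
  cases k with
  | zero => simp only [starRad, zero_add, pow_one]; nlinarith
  | succ j =>
    simp only [starRad]
    rw [pow_succ L (j + 1)]
    have : 2 * 2 ^ d ≤ L := by nlinarith
    nlinarith [Nat.zero_le (L ^ (j + 1))]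

/-- **[ABKM19] (7.88)**: for a `(k+1)`-polymer `X` (side `R = L^{k+1}`, `M = L^N`, `L` odd,
`L ≥ 2^{d+3}+16R`, `k + 1 ≤ N`), `x ∈ X*`, and `1 ≤ |α| ≤ p` with `p + d ≤ M_ord`:
`(∇^αφ(x))² · R^{d + 2|α| − 2} ≤ 8^d (φ, M_{k+1}^X φ)` where
`M_{k+1}^X = derivForm L (k+1) {1≤|γ|≤M_ord} χ_{k+1}^X`. [cite: AdamsBuchholzKoteckyMuller2019, Lemma 7.8 (7.88)] -/
theorem iterDiff_sq_le_quadForm {L N Mord R p : ℕ} (hLodd : Odd L) (hL : 2 ^ (d + 3) + 16 * R ≤ L)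
    (hM : M = L ^ N) {k : ℕ} (hk : k + 1 ≤ N) (hpM : p + d ≤ Mord) {X : Finset (Fin d → ZMod M)}
    (hX : IsPolymer (L ^ (k + 1)) X) {x : Fin d → ZMod M} (hx : x ∈ thicken (starRad R L d (k + 1)) X)
    {α : Fin d → ℕ} (hα : α ∈ diffIndex d p) (φ : (Fin d → ZMod M) → ℝ) :
    (iterDiff α φ x) ^ 2 * ((L : ℝ) ^ (k + 1)) ^ (d + 2 * ∑ i, α i - 2) ≤
      8 ^ d * (φ ⬝ᵥ derivForm (L : ℝ) (k + 1) (diffIndex d Mord)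
        (boxDensity (boxRad R L (k + 1)) (boxWt (L : ℝ) d (k + 1)) X) *ᵥ φ) := by
  obtain ⟨hα1, hαp⟩ := mem_diffIndex.1 hα
  have hL8 : 2 ^ (d + 3) ≤ L := le_trans (Nat.le_add_right _ _) hL
  have hL1 : 1 ≤ L := le_trans Nat.one_le_two_pow hL8
  have hLr : (0 : ℝ) < L := by exact_mod_cast hL1
  set Rn : ℕ := L ^ (k + 1) with hRn
  have hRn1 : 1 ≤ Rn := Nat.one_le_pow _ _ hL1
  -- the cube side `ℓ = R − starRad`, with `R/2 ≤ ℓ ≤ R`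
  have hstar := two_mul_starRad_le (d := d) hL k
  set ℓ := Rn - starRad R L d (k + 1) with hℓ
  have hℓ1 : 1 ≤ ℓ := by omega
  have h2ℓ : Rn ≤ 2 * ℓ := by omega
  have hℓR : ℓ ≤ Rn := Nat.sub_le _ _
  have hℓM : ℓ ≤ M := by
    rw [hM]; exact hℓR.trans (Nat.pow_le_pow_right hL1 hk)
  -- `χ ≥ 1` on the cube: its points lie in `X⁺ = X + [−R, R]^d`
  set χ := boxDensity (boxRad R L (k + 1)) (boxWt (L : ℝ) d (k + 1)) X with hχ
  have hχ0 : ∀ y, 0 ≤ χ y := fun y => boxDensity_nonneg _ (by unfold boxWt; positivity) X y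
  have hχ1 : ∀ v : Fin d → Fin ℓ, 1 ≤ χ (x + natVecFin v) := by
    intro v
    refine one_le_boxDensity_abkm hLodd hM hk hX ?_
    simp only [plusRad]
    have hmem : x + natVecFin (M := M) v ∈ thicken ((ℓ - 1) + starRad R L d (k + 1)) X :=
      thicken_thicken _ _ X (mem_thicken.2 ⟨x, hx, by
        rw [add_sub_cancel_left]; exact supNorm_natVecFin_le v⟩)
    exact thicken_mono_rad (by omega) X hmem
  -- Sobolev (mixed form) at `x`
  have hsob := iterDiff_sq_le_sum (M := M) hℓ1 α φ x
  set Q := φ ⬝ᵥ derivForm (L : ℝ) (k + 1) (diffIndex d Mord) χ *ᵥ φ with hQ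
  have hQ0 : 0 ≤ Q := by
    have := (posSemidef_derivForm hLr.le (k + 1) (diffIndex d Mord) hχ0).dotProduct_mulVec_nonneg φ
    rwa [star_trivial] at this
  set Rr : ℝ := (L : ℝ) ^ (k + 1) with hRr
  have hRr1 : (1 : ℝ) ≤ Rr := one_le_pow₀ (by exact_mod_cast hL1)
  have hRr0 : 0 < Rr := by positivity
  have hℓr1 : (1 : ℝ) ≤ ℓ := by exact_mod_cast hℓ1
  have hℓrR : (ℓ : ℝ) ≤ Rr := by rw [hRr]; exact_mod_cast hℓR
  have h2ℓr : Rr ≤ 2 * ℓ := by rw [hRr]; exact_mod_cast h2ℓ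
  -- each term: `(ℓ^{2#β}/ℓ^d) Σ_v (∇^{α+β}φ)² ≤ (ℓ^{2#β}/ℓ^d) R^{-2(|α|+#β-1)} Q ≤ 2^d R^{-d-2|α|+2} Q`
  set n := ∑ i, α i with hn
  have hterm : ∀ β ∈ (Finset.univ : Finset (Fin d)).powerset,
      ((ℓ : ℝ) ^ (2 * β.card) / (ℓ : ℝ) ^ d) *
        ∑ v : Fin d → Fin ℓ, (iterDiff (α + fun k => if k ∈ β then 1 else 0) φ
          (x + fun k => (((v k : ℕ)) : ZMod M))) ^ 2 ≤
        2 ^ d * Q / Rr ^ (d + 2 * n - 2) := by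
    intro β _
    have hγ : (α + fun k => if k ∈ β then 1 else 0) ∈ diffIndex d Mord := by
      rw [mem_diffIndex, sum_add_indicator]
      have := Finset.card_le_univ β; rw [Fintype.card_fin] at this
      omega
    have h1 := sum_box_sq_le_quadForm hℓM x hLr (k + 1) hγ hχ0 hχ1 φ
    rw [sum_add_indicator] at h1
    change ∑ v : Fin d → Fin ℓ, (iterDiff _ φ (x + natVecFin v)) ^ 2 ≤ _ at h1
    refine (mul_le_mul_of_nonneg_left h1 (by positivity)).trans ?_
    rw [← hQ, show (L : ℝ) ^ (2 * (k + 1) * (n + β.card - 1)) = Rr ^ (2 * (n + β.card - 1)) by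
      rw [hRr, ← pow_mul]; congr 1; ring]
    -- `ℓ^{2b} / ℓ^d / R^{2(n+b-1)} ≤ 2^d / R^{d+2n-2}`  (`ℓ ≤ R ≤ 2ℓ`, `n ≥ 1`)
    have hb : Rr ^ (d + 2 * n - 2) = Rr ^ d * Rr ^ (2 * (n - 1)) := by
      rw [← pow_add]; congr 1; omega
    have hb' : Rr ^ (2 * (n + β.card - 1)) = Rr ^ (2 * β.card) * Rr ^ (2 * (n - 1)) := by
      rw [← pow_add]; congr 1; omega
    have hℓb : (ℓ : ℝ) ^ (2 * β.card) ≤ Rr ^ (2 * β.card) := pow_le_pow_left₀ (by positivity) hℓrR _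
    have hRd : Rr ^ d ≤ (2 : ℝ) ^ d * (ℓ : ℝ) ^ d := by
      rw [← mul_pow]; exact pow_le_pow_left₀ hRr0.le h2ℓr _
    have key : (ℓ : ℝ) ^ (2 * β.card) / ((ℓ : ℝ) ^ d * Rr ^ (2 * (n + β.card - 1))) ≤
        2 ^ d / Rr ^ (d + 2 * n - 2) := by
      rw [div_le_div_iff₀ (by positivity) (by positivity), hb, hb']
      calc (ℓ : ℝ) ^ (2 * β.card) * (Rr ^ d * Rr ^ (2 * (n - 1)))
          ≤ Rr ^ (2 * β.card) * ((2 : ℝ) ^ d * (ℓ : ℝ) ^ d * Rr ^ (2 * (n - 1))) := by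
            gcongr
        _ = 2 ^ d * ((ℓ : ℝ) ^ d * (Rr ^ (2 * β.card) * Rr ^ (2 * (n - 1)))) := by ring
    have hℓ0 : (ℓ : ℝ) ^ d ≠ 0 := by positivity
    have hR0 : Rr ^ (2 * (n + β.card - 1)) ≠ 0 := by positivity
    calc (ℓ : ℝ) ^ (2 * β.card) / (ℓ : ℝ) ^ d * ((Rr ^ (2 * (n + β.card - 1)))⁻¹ * Q)
        = Q * ((ℓ : ℝ) ^ (2 * β.card) / ((ℓ : ℝ) ^ d * Rr ^ (2 * (n + β.card - 1)))) := by
          field_simp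
      _ ≤ Q * (2 ^ d / Rr ^ (d + 2 * n - 2)) := mul_le_mul_of_nonneg_left key hQ0
      _ = 2 ^ d * Q / Rr ^ (d + 2 * n - 2) := by ring
  -- sum over the `2^d` subsets
  have hsum := Finset.sum_le_sum hterm
  rw [Finset.sum_const, Finset.card_powerset, Finset.card_univ, Fintype.card_fin, nsmul_eq_mul] at hsum
  have hmain : (iterDiff α φ x) ^ 2 ≤ 2 ^ d * (2 ^ d * (2 ^ d * Q / Rr ^ (d + 2 * n - 2))) :=
    hsob.trans (mul_le_mul_of_nonneg_left (by exact_mod_cast hsum) (by positivity))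
  have hRpos : 0 < Rr ^ (d + 2 * n - 2) := by positivity
  calc iterDiff α φ x ^ 2 * Rr ^ (d + 2 * n - 2)
      ≤ 2 ^ d * (2 ^ d * (2 ^ d * Q / Rr ^ (d + 2 * n - 2))) * Rr ^ (d + 2 * n - 2) :=
        mul_le_mul_of_nonneg_right hmain hRpos.le
    _ = 8 ^ d * Q := by
        have h8 : (8 : ℝ) ^ d = 2 ^ d * 2 ^ d * 2 ^ d := by rw [← mul_pow, ← mul_pow]; norm_num
        rw [h8, show (2 : ℝ) ^ d * (2 ^ d * (2 ^ d * Q / Rr ^ (d + 2 * n - 2))) * Rr ^ (d + 2 * n - 2) =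
          2 ^ d * 2 ^ d * 2 ^ d * Q * (Rr ^ (d + 2 * n - 2) / Rr ^ (d + 2 * n - 2)) by ring,
          div_self hRpos.ne', mul_one]

/-- **[ABKM19] Lemma 7.8 for the torus weight data**: with `R = L^{k+1}` and the field gauge of
`X* = X + [−starRad_{k+1}, starRad_{k+1}]^d` with weights `(𝔥, R)` and orders `≤ p` (`p + d ≤ M_ord`),
for a `(k+1)`-polymer `X` and every field `φ`:
`‖T_{X*}φ‖² ≤ (φ, pert_{k+1}^X φ)` provided `8^d θ_max ≤ δ'_{k+1} 𝔥² R^{d−2}`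
(for [ABKM19]'s `𝔥 = h_{k+1}L^{−(k+1)(d−2)/2}` this reads `h_{k+1}² δ_{k+1}… ≥ 8^d`: the condition
`h ≥ h₀(L)`). [cite: AdamsBuchholzKoteckyMuller2019, Lemma 7.8] -/
theorem fieldGauge_sq_le_pert {L N Mord R p : ℕ} (hd : 2 ≤ d) (hLodd : Odd L)
    (hL : 2 ^ (d + 3) + 16 * R ≤ L)
    (hM : M = L ^ N) {k : ℕ} (hk : k + 1 ≤ N) (hpM : p + d ≤ Mord) (θbar : ℝ) {δ' : ℕ → ℝ}
    (𝒞 : ℕ → (Fin d → ZMod M) → ℝ) {𝔥 : ℝ} (h𝔥 : 0 < 𝔥)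
    (hh : (8 : ℝ) ^ d * thetaMax R d ≤ δ' (k + 1) * 𝔥 ^ 2 * ((L : ℝ) ^ (k + 1)) ^ (d - 2))
    {X : Finset (Fin d → ZMod M)} (hX : IsPolymer (L ^ (k + 1)) X) (φ : (Fin d → ZMod M) → ℝ) :
    ‖fieldGauge 𝔥 ((L : ℝ) ^ (k + 1)) p (thicken (starRad R L d (k + 1)) X) φ‖ ^ 2 ≤
      φ ⬝ᵥ (abkmWeightData L N Mord R θbar δ' 𝒞).pert (k + 1) X *ᵥ φ := by
  have hL1 : 1 ≤ L := le_trans Nat.one_le_two_pow (le_trans (Nat.le_add_right _ _) hL)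
  set Rr : ℝ := (L : ℝ) ^ (k + 1) with hRr
  have hRr0 : 0 < Rr := by positivity
  have hθ := thetaMax_pos R d
  set Q := φ ⬝ᵥ derivForm (L : ℝ) (k + 1) (diffIndex d Mord)
    (boxDensity (boxRad R L (k + 1)) (boxWt (L : ℝ) d (k + 1)) X) *ᵥ φ with hQ
  have hQ0 : 0 ≤ Q := by
    have := (posSemidef_derivForm (show (0:ℝ) ≤ L by positivity) (k + 1) (diffIndex d Mord)
      (fun y => boxDensity_nonneg (boxRad R L (k + 1)) (w := boxWt (L : ℝ) d (k + 1))
        (by unfold boxWt; positivity) X y)).dotProduct_mulVec_nonneg φ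
    rwa [star_trivial] at this
  have hpert : φ ⬝ᵥ (abkmWeightData L N Mord R θbar δ' 𝒞).pert (k + 1) X *ᵥ φ =
      δ' (k + 1) / thetaMax R d * Q := by
    rw [abkmWeightData, geomWeightData_pert, Matrix.smul_mulVec, dotProduct_smul, smul_eq_mul]
  have hδ : 0 ≤ δ' (k + 1) := by
    by_contra hneg
    have : δ' (k + 1) * 𝔥 ^ 2 * Rr ^ (d - 2) ≤ 0 :=
      mul_nonpos_of_nonpos_of_nonneg (mul_nonpos_of_nonpos_of_nonneg (le_of_lt (not_le.1 hneg))
        (sq_nonneg _)) (by positivity)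
    have : (0 : ℝ) < 8 ^ d * thetaMax R d := by positivity
    linarith
  -- every component squared is at most the bound
  set B : ℝ := δ' (k + 1) / thetaMax R d * Q with hB
  have hB0 : 0 ≤ B := mul_nonneg (div_nonneg hδ hθ.le) hQ0
  have hcomp : ∀ q : ↥(thicken (starRad R L d (k + 1)) X) × ↥(diffIndex d p),
      (fieldGauge 𝔥 Rr p (thicken (starRad R L d (k + 1)) X) φ q) ^ 2 ≤ B := by
    rintro ⟨⟨x, hx⟩, ⟨α, hα⟩⟩
    rw [fieldGauge_apply]
    have hcore := iterDiff_sq_le_quadForm hLodd hL hM hk hpM hX hx hα φ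
    rw [← hQ] at hcore
    set n := ∑ i, α i
    have hn1 : 1 ≤ n := (mem_diffIndex.1 hα).1
    -- `(𝔥⁻¹ R^n ∇^αφ(x))² = 𝔥⁻² R^{2n} (∇^αφ)² ≤ 𝔥⁻² R^{2−d} 8^d Q ≤ (δ'/θmax) Q`
    have hpow : Rr ^ (2 * n) = Rr ^ (d + 2 * n - 2) / Rr ^ (d - 2) := by
      rw [eq_div_iff (by positivity), ← pow_add]; congr 1; omega
    have h1 : (𝔥⁻¹ * Rr ^ n * iterDiff α φ x) ^ 2 =
        (𝔥 ^ 2)⁻¹ * ((iterDiff α φ x) ^ 2 * Rr ^ (d + 2 * n - 2)) / Rr ^ (d - 2) := by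
      rw [mul_pow, mul_pow, ← pow_mul, mul_comm n 2, hpow, inv_pow]; ring
    rw [h1, div_le_iff₀ (by positivity)]
    calc (𝔥 ^ 2)⁻¹ * (iterDiff α φ x ^ 2 * Rr ^ (d + 2 * n - 2))
        ≤ (𝔥 ^ 2)⁻¹ * (8 ^ d * Q) := mul_le_mul_of_nonneg_left hcore (by positivity)
      _ ≤ B * Rr ^ (d - 2) := by
          rw [hB]
          -- `8^d Q ≤ 𝔥² R^{d-2} (δ'/θmax) Q` from `hh`
          have h2 : (8 : ℝ) ^ d ≤ δ' (k + 1) / thetaMax R d * 𝔥 ^ 2 * Rr ^ (d - 2) := by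
            rw [div_mul_eq_mul_div, div_mul_eq_mul_div, le_div_iff₀ hθ]; exact hh
          have h3 := mul_le_mul_of_nonneg_right h2 hQ0
          have h𝔥2 : 0 < 𝔥 ^ 2 := by positivity
          rw [inv_mul_le_iff₀ h𝔥2]
          calc (8 : ℝ) ^ d * Q ≤ δ' (k + 1) / thetaMax R d * 𝔥 ^ 2 * Rr ^ (d - 2) * Q := h3
            _ = 𝔥 ^ 2 * (δ' (k + 1) / thetaMax R d * Q * Rr ^ (d - 2)) := by ring
  -- from components to the sup norm
  rw [hpert]
  have hnorm : ‖fieldGauge 𝔥 Rr p (thicken (starRad R L d (k + 1)) X) φ‖ ≤ Real.sqrt B := by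
    refine (pi_norm_le_iff_of_nonneg (Real.sqrt_nonneg B)).2 fun q => ?_
    rw [Real.norm_eq_abs]
    exact Real.abs_le_sqrt (hcomp q)
  calc ‖fieldGauge 𝔥 Rr p (thicken (starRad R L d (k + 1)) X) φ‖ ^ 2 ≤ Real.sqrt B ^ 2 :=
      pow_le_pow_left₀ (norm_nonneg _) hnorm 2
    _ = B := Real.sq_sqrt hB0

/-- **[ABKM19] Theorem 7.1 (w9) for the torus weight data**: under the hypotheses of
`fieldGauge_sq_le_pert`, `Dominated` and `Monotone`:
`e^{‖T_{X*}φ‖²/2} w_{k:k+1}^X(φ) ≤ w_{k+1}^X(φ)`. [cite: AdamsBuchholzKoteckyMuller2019, Theorem 7.1 (w9)] -/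
theorem exp_fieldGauge_sq_mul_midWeight_le {L N Mord R p : ℕ} (hd : 2 ≤ d) (hLodd : Odd L)
    (hL : 2 ^ (d + 3) + 16 * R ≤ L) (hM : M = L ^ N) {k : ℕ} (hk : k + 1 ≤ N) (hpM : p + d ≤ Mord)
    {θbar : ℝ} {δ' : ℕ → ℝ} {𝒞 : ℕ → (Fin d → ZMod M) → ℝ} {D : ℕ → Matrix (Fin d → ZMod M) (Fin d → ZMod M) ℝ}
    (hD : (abkmWeightData L N Mord R θbar δ' 𝒞).Dominated D)
    (hm : (abkmWeightData L N Mord R θbar δ' 𝒞).Monotone) {𝔥 : ℝ} (h𝔥 : 0 < 𝔥)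
    (hh : (8 : ℝ) ^ d * thetaMax R d ≤ δ' (k + 1) * 𝔥 ^ 2 * ((L : ℝ) ^ (k + 1)) ^ (d - 2))
    {X : Finset (Fin d → ZMod M)} (hX : IsPolymer (L ^ (k + 1)) X) (φ : (Fin d → ZMod M) → ℝ) :
    Real.exp (‖fieldGauge 𝔥 ((L : ℝ) ^ (k + 1)) p (thicken (starRad R L d (k + 1)) X) φ‖ ^ 2 / 2) *
        (abkmWeightData L N Mord R θbar δ' 𝒞).midWeight k X φ ≤
      (abkmWeightData L N Mord R θbar δ' 𝒞).weight (k + 1) X φ :=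
  WeightData.exp_mul_midWeight_le_weight_succ hD hm (subset_thicken _ X)
    (fieldGauge_sq_le_pert hd hLodd hL hM hk hpM θbar 𝒞 h𝔥 hh hX φ)

end Literature.MathematicalPhysics.StatisticalMechanics.GradientRG

end
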